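import Summits.HodgeConjecture.HodgeConjecture.Theorems.HeckePrymWeilProductDescentOfDeRham
import Literature.AlgebraicGeometry.HodgeTheory.WeilClassesSurfacesAlgebraic
import Literature.NumberTheory.Transcendental.DeRhamTheoremMultiplicative

/-!
# `WeilDescending` (stmt-HodgeConjecture-1263) · III · unconditional proof

Route `HeckePrymWeil`, support item `WeilDescending`: for a prime `p ≡ 3 (4)`, `p ≥ 7` and `n ≥ 1`,
the rung predicate `HWA(p, n+1)` of `HodgeWeilLadder` implies `HWA(p, n)` (Koike's descending
trick, doi:10.4153/cmb-2004-055-x, Thm. 2.1; Schoen, Compositio Math. 114 (1998) §10, Proposition;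
Markman, arXiv:2509.23403 §11.5 Step 2 — made component-free by the route).

This file closes the item WITHOUT named-fact hypotheses, by composing three pieces of the tree:

* `productDescentAt_of_deRham` (`Theorems/HeckePrymWeilProductDescentOfDeRham`) — Schoen's product
  step, downward half, for ONE Weil pair `(A, φ)` and a GIVEN partner `(B, ψ, b, t)` (`b` a rational
  `(1,1)` class of `B` in the two `(𝟙+ψ)^*`-eigenspaces, `t` a rational ALGEBRAIC class with
  `b ∪ t ≠ 0`), from de Rham's theorem in multiplicative form;
* `exists_weilType_abelianSurfaces_algebraic` (`Literature/…/WeilClassesSurfacesAlgebraic`) — for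
  every `d ≥ 1` the companion surface `B = E_i × E_i` with `ψ ∘ ψ = -d` and a rational `(1,1)` class
  `b` of its Weil plane which is an ALGEBRAIC divisor class with `b ∪ b ≠ 0` (so `t := b`);
* `exists_deRhamIsoFamily_holds` (`Literature/…/DeRhamTheoremMultiplicative`) — de Rham's theorem,
  natural, multiplicative and normalised (Warner GTM 94, Thm. 5.36 / 5.45), now a theorem of the tree.

The hypothesis `HWA(p, n+1)` is applied to the abelian variety `A × B` of dimension `2(n+1)`
(`dim_prod_eq_two_mul`) with the endomorphism `φ × ψ`, `(φ × ψ)² = -p`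
(`prodLift_comp_self_eq_neg_zsmul`); the Weil plane `E₊ ⊔ E₋` of `(B, ψ)` lies in the two
eigenspaces of the single operator `(𝟙 + ψ)^*` (test endomorphism `x = y = 1`), exactly as in
file II's `weilDescending_of_productDescent`.
-/

noncomputable section

-- every declaration of this problem lives in `Summit.HodgeConjecture.HodgeConjecture.…` (summit = sub-problem)
set_option linter.dupNamespace false

open scoped Manifold
open CategoryTheory
open Literature.AlgebraicGeometry Literature.AlgebraicGeometry.HodgeTheory
open Literature.AlgebraicTopology.SingularHomology

namespace Summit.HodgeConjecture.HodgeConjecture.Theorems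

/-- **`WeilDescending` (route `HeckePrymWeil`, item stmt-HodgeConjecture-1263), unconditionally.**
For `p ≡ 3 (4)` prime, `p ≥ 7`, `n ≥ 1`: the rung `HWA(p, n+1)` implies `HWA(p, n)`. Proof: given
`(A, φ)` of dimension `2n` with `φ ∘ φ = -p` and a rational `(n,n)` class `c` in the Weil plane of
`(𝟙+φ)^*`, take the companion surface `(B, ψ, b)` of `exists_weilType_abelianSurfaces_algebraic`
at `d = p` (`b` rational, `(1,1)`, in the Weil plane, algebraic, `b ∪ b ≠ 0`) and apply Schoen's
transfer `productDescentAt_of_deRham` with partner `t := b`, the multiplicative de Rham theorem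
`exists_deRhamIsoFamily_holds`, and the rung `HWA(p, n+1)` on `A × B` (dimension `2(n+1)`,
`(φ × ψ)² = -p`). [cite: Schoen1998HodgeWeilAddendum, §10 (Proposition and proof)]
[cite: Markman2025SurveySecant, §11.5 Step 2] -/
theorem weilDescending_proof : Theses.HeckePrymWeil.WeilDescending := by
  intro p _hp _hp4 hp7 n hn hyp A φ hA hφ c hc hcH hcW
  -- the companion Weil surface with its algebraic Weil divisor class
  obtain ⟨B, ψ, b, hBdim, hψ, hbr, hbH, hbW, hbalg, hbb⟩ :=
    exists_weilType_abelianSurfaces_algebraic p (by omega)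
  have hψ' : ψ ≫ ψ = -((p : ℤ) • 𝟙 B) := by rw [natCast_zsmul]; exact hψ
  have hBdim' : B.dim = 2 * 1 := by rw [hBdim]
  -- the Weil plane of `(B, ψ)` lies in the two `(𝟙 + ψ)^*`-eigenspaces
  have hbW' : b ∈ Module.End.eigenspace (complexBetti.map (𝟙 B + ψ).hom.hom.hom (2 * 1)).hom
          ((1 + Complex.I * (Real.sqrt (p : ℝ) : ℂ)) ^ (2 * 1)) ⊔
        Module.End.eigenspace (complexBetti.map (𝟙 B + ψ).hom.hom.hom (2 * 1)).hom
          ((1 - Complex.I * (Real.sqrt (p : ℝ) : ℂ)) ^ (2 * 1)) := by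
    rw [weilClassesOf, Submodule.mem_sup] at hbW
    obtain ⟨bp, hbp, bm, hbm, rfl⟩ := hbW
    refine Submodule.add_mem _ (Submodule.mem_sup_left ?_) (Submodule.mem_sup_right ?_)
    · rw [Module.End.mem_eigenspace_iff]
      have e := (mem_weilClassesPlus_iff.mp hbp) 1 1
      simp only [Nat.cast_one, one_mul, one_smul] at e
      exact e
    · rw [Module.End.mem_eigenspace_iff]
      have e := (mem_weilClassesMinus_iff.mp hbm) 1 1
      simp only [Nat.cast_one, one_mul, one_smul] at e
      exact e
  -- Schoen's transfer with partner `t := b`, de Rham's theorem, and the rung on `A × B`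
  exact productDescentAt_of_deRham
    (fun E _ _ _ => Literature.NumberTheory.Transcendental.exists_deRhamIsoFamily_holds E)
    (by omega) hn φ hA ψ hBdim hbr hbH hbW' hbr hbalg hbb
    (hyp (n + 1) rfl (A.prod B) _ (dim_prod_eq_two_mul hA hBdim')
      (prodLift_comp_self_eq_neg_zsmul hφ hψ'))
    hc hcH hcW

end Summit.HodgeConjecture.HodgeConjecture.Theorems

end
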